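import Mathlib
import Summits.ValiantsHypothesis.ValiantsHypothesis.Theorems.NewtonUnitEquationsTwoProductsRankOneFourLawPlanar
import HarnessLib

/-!
# `relation_ladder` — R8 TYPED TARGET (val-idea-8 g3, 2026-08-28): ONE-SIDED rank one `p·α = Σ_{i<k} q_i·β_i`
Typed statement + witness + the embeddings of the R7b (`k = 2`) and R7c (`k = 1`) witnesses.  NOT a rung yet, NOT in the cone of
`Lines/relation_ladder.lean` (v20).  Engine: memo `Lines/relation_ladder_R8_engine.md` rev 2; slice count `Lines/relation_ladder_R8_simplex.lean`.
Nothing here moves VP ≠ VNP; 5906 / `PlanarCellBound` OPEN.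
-/

set_option linter.dupNamespace false

namespace Summit.ValiantsHypothesis.ValiantsHypothesis.Theorems.NewtonUnitEquations.TwoProducts.PermutationType.R8

open MvPolynomial
open Summit.ValiantsHypothesis.ValiantsHypothesis.Theorems.NewtonUnitEquations.TwoProducts.FormalLogLinearisation
open Summit.ValiantsHypothesis.ValiantsHypothesis.Theorems.NewtonUnitEquations.TwoProducts.PlanarCell

variable {m : ℕ}

/-- A ONE-SIDED rank-one witness: pairwise distinct tail letters `α, β_0, …, β_{k-1}` (`k ≥ 1`), a relation `p·α = Σ q_i β_i` with all
`p, q_i ≥ 1`, and every additive coincidence of the family a multiple of it (`RankOneCoincidences`, R6 convention). -/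
def OneSidedRankOne (A : Fin m → Finset Expo) : Prop :=
  ∃ (α : Expo) (p k : ℕ) (β : Fin k → Expo) (q : Fin k → ℕ), 1 ≤ p ∧ 1 ≤ k ∧ (∀ i, 1 ≤ q i) ∧ Function.Injective β ∧
    (∀ i, β i ≠ α) ∧ p • α = ∑ i, q i • β i ∧
    RankOneCoincidences A (∑ i, Finsupp.single (β i) (q i)) (Finsupp.single α p)

/-- **R8 (typed target): the one-sided rank-one law.**  `k = 1` is R7c (`RankOneTwoLaw`), `k = 2` is R7b (`RankOneThreeGenLaw`). -/
def RankOneOneSidedLaw : Prop :=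
  ∃ c : ℕ, ∀ (m : ℕ) (u v : Fin m → MvPolynomial (Fin 2) ℂ), (∀ j, coeff 0 (u j) = 0) → (∀ j, coeff 0 (v j) = 0) →
    OneSidedRankOne (fun j => (u j).support ∪ (v j).support) →
    ∀ S : Finset Expo, (∀ l ∈ S, ∃ ξ : Fin 2 → ℝ, ValidWeight u v ξ ∧ IsStrictTop ξ ↑(tailDiff u v).support l) →
      S.card ≤ 2 ^ (c * m) * ((tailSupport u v).card + 2) ^ c

/-- The R7c witness (`pα = qβ`, `α ≠ β`) is one-sided with `k = 1`. -/
theorem oneSided_of_two (A : Fin m → Finset Expo) (α β : Expo) (p q : ℕ) (hp : 1 ≤ p) (hq : 1 ≤ q) (hab : α ≠ β)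
    (hrel : p • α = q • β) (hR : RankOneCoincidences A (Finsupp.single β q) (Finsupp.single α p)) :
    OneSidedRankOne A := by
  refine ⟨α, p, 1, ![β], ![q], hp, le_rfl, fun i => ?_, fun i j _ => Subsingleton.elim i j, fun i => ?_, ?_, ?_⟩
  · fin_cases i; exact hq
  · fin_cases i; exact hab.symm
  · simpa using hrel
  · simpa using hR

/-- The R7b witness (`pα = qβ + rγ`, distinct letters) is one-sided with `k = 2`. -/
theorem oneSided_of_three (A : Fin m → Finset Expo) (α β γ : Expo) (p q r : ℕ) (hp : 1 ≤ p) (hq : 1 ≤ q) (hr : 1 ≤ r)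
    (hab : α ≠ β) (hac : α ≠ γ) (hbc : β ≠ γ) (hrel : p • α = q • β + r • γ)
    (hR : RankOneCoincidences A (Finsupp.single β q + Finsupp.single γ r) (Finsupp.single α p)) :
    OneSidedRankOne A := by
  refine ⟨α, p, 2, ![β, γ], ![q, r], hp, by norm_num, fun i => ?_, fun i j h => ?_, fun i => ?_, ?_, ?_⟩
  · fin_cases i <;> assumption
  · fin_cases i <;> fin_cases j <;> simp_all
  · fin_cases i
    · exact hab.symm
    · exact hac.symm
  · simpa [Fin.sum_univ_two] using hrel
  · simpa [Fin.sum_univ_two] using hR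

end Summit.ValiantsHypothesis.ValiantsHypothesis.Theorems.NewtonUnitEquations.TwoProducts.PermutationType.R8
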